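import Summits.PneNP.PneNP.Theorems.KarlinRubinMonotoneBlindFormCircuitDefs
import Summits.PneNP.PneNP.Theorems.KarlinRubinMonotoneBlindFormBlind
import Summits.PneNP.PneNP.Theorems.KarlinRubinMonotoneBlindStubBlindAndDnf

/-!
# Route KarlinRubin, crux `MonotoneBlind` (stmt-PneNP-18027): `MonotoneBlind` FOR MONOTONE AC⁰ CIRCUITS

The crux `MonotoneBlind` restricted to constant `acDepth`, in the library's circuit vocabulary
(`karlinRubin_monotoneBlind_AC0`): for `0 < δ < 1/2` and all constants `c, d` there is NO sequence of circuits `C n`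
on the edge slots of `Kₙ` over the unbounded fan-in monotone basis `monotoneACBasis = {∧ₘ, ∨ₘ | m}` with
`size ≤ n^c` and `acDepth ≤ d` (eventually) such that
`Pr_{G(n,1/2)}[C n = 1] + Pr_{G(n,1/2,⌈n^{1/2-δ}⌉)}[C n = 0] → 0`.

Proof: unfold the output wire into the layered formula `swUnfold gates (2d+1) false output` (`…FormCircuitDefs`);
it computes the circuit (`swEval_swUnfold`: two levels per unit of height suffice, by strong induction on the level)
and has fan-ins `≤ size + #slots + 1 ≤ n^{c+3}` above single slots (`swBnd_swUnfold`), so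
`karlinRubin_monotoneBlind_constDepth'` (`…FormBlind`) applies.

All `--supports stmt-PneNP-18027`; no definitions.
-/

set_option linter.dupNamespace false -- `Summit.PneNP.PneNP.…`: summit = sub-problem (D-0017)

namespace Summit.PneNP.PneNP.Theorems

open Finset Filter Topology
open scoped ENNReal
open Literature.Computability.Complexity
open Literature.Computability.Complexity.GateList
open Literature.Probability.RandomGraphs.PlantedClique

variable {n : ℕ}

/-! ### Monotone unbounded fan-in gates -/

/-- A gate over `monotoneACBasis` is the `∧` or the `∨` of its own arity. [folklore] -/
theorem fn_eq_of_mem_monotoneACBasis {ι : Type*} {g : Gate ι} (h : g.fn ∈ monotoneACBasis) :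
    g.fn = GateFn.and g.arity ∨ g.fn = GateFn.or g.arity := by
  simp only [monotoneACBasis, Set.mem_iUnion, Set.mem_insert_iff, Set.mem_singleton_iff] at h
  obtain ⟨m, hm | hm⟩ := h
  · have : g.arity = m := congrArg Sigma.fst hm
    subst this; exact Or.inl hm
  · have : g.arity = m := congrArg Sigma.fst hm
    subst this; exact Or.inr hm

/-- The height of a monotone gate is one more than the maximal height of its arguments. [folklore] -/
theorem wireHt_args_lt {ι : Type*} {gs : List (Gate ι)} (hwf : WF gs) (hB : ∀ g ∈ gs, g.fn ∈ monotoneACBasis)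
    {m : ℕ} (hm : m < gs.length) (a : Fin (gs[m]).arity) :
    wireHt gs ((gs[m]).args a) + 1 ≤ wireHt gs (.inr m) := by
  rw [wireHt_gate hwf hm]
  have h1 : acWeight (gs[m]).fn = 1 := by
    rcases fn_eq_of_mem_monotoneACBasis (hB _ (List.getElem_mem hm)) with h | h
    · rw [h, acWeight_and]
    · rw [h, acWeight_or]
  rw [h1]
  have h2 := Finset.le_sup (f := fun a => wireHt gs ((gs[m]).args a)) (mem_univ a)
  omega

/-- A monotone gate has height `≥ 1`. [folklore] -/
theorem one_le_wireHt_inr {ι : Type*} {gs : List (Gate ι)} (hwf : WF gs) (hB : ∀ g ∈ gs, g.fn ∈ monotoneACBasis)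
    {m : ℕ} (hm : m < gs.length) : 1 ≤ wireHt gs (.inr m) := by
  rw [wireHt_gate hwf hm]
  rcases fn_eq_of_mem_monotoneACBasis (hB _ (List.getElem_mem hm)) with h | h
  · rw [h, acWeight_and]; exact Nat.le_add_right 1 _
  · rw [h, acWeight_or]; exact Nat.le_add_right 1 _

/-! ### The unfolding computes the circuit -/

/-- One node of the unfolding: a gate of the required polarity over its unfolded arguments. [folklore] -/
theorem swEval_node_args {gs : List (Gate (⊤ : SimpleGraph (Fin n)).edgeSet)} (hwf : WF gs) (x : EdgeVec n)
    {L : ℕ} {q : Bool} {m : ℕ} (hm : m < gs.length)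
    (hmatch : (gs[m]).fn = (if q then GateFn.or (gs[m]).arity else GateFn.and (gs[m]).arity))
    (IH : ∀ w' ∈ List.ofFn (gs[m]).args, (swEval L (!q) (swUnfold gs L (!q) w') x ↔ wireFn gs w' x = true)) :
    swEval (L + 1) q (swForm.node (((List.ofFn (gs[m]).args).dedup).map fun w => swUnfold gs L (!q) w)) x ↔
      wireFn gs (.inr m) x = true := by
  rw [wireFn_gate hwf hm]
  cases q
  · simp only [Bool.false_eq_true, ↓reduceIte] at hmatch
    rw [op_of_fn_eq_and hmatch, decide_eq_true_eq, swEval_succ_false]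
    simp only [swForm.kids, List.mem_map, List.mem_dedup, Bool.not_false]
    constructor
    · intro h a
      exact (IH _ (List.mem_ofFn.2 ⟨a, rfl⟩)).1 (h _ ⟨(gs[m]).args a, List.mem_ofFn.2 ⟨a, rfl⟩, rfl⟩)
    · rintro h g ⟨w', hw', rfl⟩
      obtain ⟨a, rfl⟩ := List.mem_ofFn.1 hw'
      exact (IH _ hw').2 (h a)
  · simp only [↓reduceIte] at hmatch
    rw [op_of_fn_eq_or hmatch, decide_eq_true_eq, swEval_succ_true]
    simp only [swForm.kids, List.mem_map, List.mem_dedup, Bool.not_true]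
    constructor
    · rintro ⟨g, ⟨w', hw', rfl⟩, hg⟩
      obtain ⟨a, rfl⟩ := List.mem_ofFn.1 hw'
      exact ⟨a, (IH _ hw').1 hg⟩
    · rintro ⟨a, ha⟩
      exact ⟨_, ⟨(gs[m]).args a, List.mem_ofFn.2 ⟨a, rfl⟩, rfl⟩,
        (IH _ (List.mem_ofFn.2 ⟨a, rfl⟩)).2 ha⟩

/-- **The unfolding computes the wire**: for a well-formed program over `monotoneACBasis`, a wire of height `h` with
`2h ≤ ℓ` unfolds, at any polarity, to a level-`ℓ` layered formula with the same truth table. [folklore] -/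
theorem swEval_swUnfold {gs : List (Gate (⊤ : SimpleGraph (Fin n)).edgeSet)} (hwf : WF gs)
    (hB : ∀ g ∈ gs, g.fn ∈ monotoneACBasis) (x : EdgeVec n) :
    ∀ (ℓ : ℕ) (pol : Bool) (w : (⊤ : SimpleGraph (Fin n)).edgeSet ⊕ ℕ), (∀ m, w = .inr m → m < gs.length) →
      2 * wireHt gs w ≤ ℓ → (swEval ℓ pol (swUnfold gs ℓ pol w) x ↔ wireFn gs w x = true) := by
  intro ℓ
  induction ℓ using Nat.strong_induction_on with
  | _ ℓ ih =>
    intro pol w hw hht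
    cases ℓ with
    | zero =>
      cases w with
      | inl e =>
        rw [swUnfold_zero_inl, wireFn_inl]
        cases pol
        · rw [swEval_zero_false]; simp [swForm.leaf, swForm.sets]
        · rw [swEval_zero_true]; simp [swForm.leaf, swForm.sets]
      | inr m =>
        have := one_le_wireHt_inr hwf hB (hw m rfl)
        omega
    | succ ℓ =>
      cases w with
      | inl e =>
        rw [swUnfold_succ_inl, wireFn_inl]
        have h0 := ih ℓ (Nat.lt_succ_self ℓ) (!pol) (.inl e) (fun m hm => by cases hm) (by simp)
        rw [wireFn_inl] at h0
        cases pol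
        · rw [swEval_succ_false]; simpa [swForm.kids] using h0
        · rw [swEval_succ_true]; simpa [swForm.kids] using h0
      | inr m =>
        have hm : m < gs.length := hw m rfl
        have hargs : ∀ a : Fin (gs[m]).arity, 2 * wireHt gs ((gs[m]).args a) + 2 ≤ ℓ + 1 := by
          intro a
          have := wireHt_args_lt hwf hB hm a
          omega
        have hargs_ok : ∀ (a : Fin (gs[m]).arity) (m' : ℕ), (gs[m]).args a = .inr m' → m' < gs.length :=
          fun a m' h => (args_lt hwf hm a h).trans hm
        -- the induction hypothesis for the argument wires, at any level `L ≥ ℓ - 1` below `ℓ + 1`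
        have IHargs : ∀ (L : ℕ) (q : Bool), L < ℓ + 1 → ℓ ≤ L + 1 →
            ∀ w' ∈ List.ofFn (gs[m]).args, (swEval L q (swUnfold gs L q w') x ↔ wireFn gs w' x = true) := by
          intro L q hL hL' w' hw'
          obtain ⟨a, rfl⟩ := List.mem_ofFn.1 hw'
          exact ih L hL q _ (hargs_ok a) (by have := hargs a; omega)
        have hfn := fn_eq_of_mem_monotoneACBasis (hB _ (List.getElem_mem hm))
        by_cases hmatch : (gs[m]).fn = (if pol then GateFn.or (gs[m]).arity else GateFn.and (gs[m]).arity)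
        · -- the gate has the required polarity
          rw [swUnfold_succ_inr, dif_pos hm, if_pos hmatch]
          exact swEval_node_args hwf x hm hmatch (IHargs ℓ _ (Nat.lt_succ_self ℓ) (Nat.le_succ ℓ))
        · -- wrap: one level down the gate has the required polarity
          have hmatch' : (gs[m]).fn = (if (!pol) then GateFn.or (gs[m]).arity else GateFn.and (gs[m]).arity) := by
            cases pol
            · simp only [Bool.false_eq_true, ↓reduceIte] at hmatch
              simpa using hfn.resolve_left hmatch
            · simp only [↓reduceIte] at hmatch
              simpa using hfn.resolve_right hmatch
          rw [swUnfold_succ_inr, dif_pos hm, if_neg hmatch]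
          have hkid : swEval (ℓ + 1) pol (swForm.node [swUnfold gs ℓ (!pol) (.inr m)]) x ↔
              swEval ℓ (!pol) (swUnfold gs ℓ (!pol) (.inr m)) x := by
            cases pol
            · rw [swEval_succ_false]; simp [swForm.kids]
            · rw [swEval_succ_true]; simp [swForm.kids]
          rw [hkid]
          cases ℓ with
          | zero => have := one_le_wireHt_inr hwf hB hm; omega
          | succ ℓ' =>
            rw [swUnfold_succ_inr, dif_pos hm, if_pos hmatch']
            have h := swEval_node_args hwf x hm hmatch' (IHargs ℓ' _ (by omega) (by omega))
            simpa only [Bool.not_not] using h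

/-! ### The unfolding has polynomial fan-ins above single slots -/

/-- `swBnd` is monotone in the fan-in bound. [folklore] -/
theorem swBnd_mono {M M' L : ℕ} (hM : M ≤ M') : ∀ (d : ℕ) (f : swForm n d), swBnd M L d f → swBnd M' L d f := by
  intro d
  induction d with
  | zero => intro f hf; rw [swBnd_zero] at hf ⊢; exact hf
  | succ d ih =>
    intro f hf
    rw [swBnd_succ] at hf ⊢
    exact ⟨hf.1.trans hM, fun g hg => ih g (hf.2 g hg)⟩

open Classical in
/-- The deduplicated argument list of a gate of a well-formed program has at most `#gates + #slots` wires. [folklore] -/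
theorem length_dedup_args_le {gs : List (Gate (⊤ : SimpleGraph (Fin n)).edgeSet)} (hwf : WF gs) {m : ℕ}
    (hm : m < gs.length) :
    ((List.ofFn (gs[m]).args).dedup).length ≤ gs.length + Fintype.card (⊤ : SimpleGraph (Fin n)).edgeSet := by
  set S : Finset ((⊤ : SimpleGraph (Fin n)).edgeSet ⊕ ℕ) :=
    (univ : Finset (⊤ : SimpleGraph (Fin n)).edgeSet).map ⟨Sum.inl, Sum.inl_injective⟩ ∪
      (range gs.length).map ⟨Sum.inr, Sum.inr_injective⟩ with hS
  have hsub : ((List.ofFn (gs[m]).args).dedup).toFinset ⊆ S := by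
    intro w hw
    rw [List.mem_toFinset, List.mem_dedup, List.mem_ofFn] at hw
    obtain ⟨a, rfl⟩ := hw
    rw [hS, mem_union]
    cases h : (gs[m]).args a with
    | inl e => exact Or.inl (mem_map.2 ⟨e, mem_univ _, rfl⟩)
    | inr m' => exact Or.inr (mem_map.2 ⟨m', mem_range.2 ((args_lt hwf hm a h).trans hm), rfl⟩)
  calc ((List.ofFn (gs[m]).args).dedup).length = ((List.ofFn (gs[m]).args).dedup).toFinset.card :=
        (List.toFinset_card_of_nodup (List.nodup_dedup _)).symm
    _ ≤ S.card := card_le_card hsub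
    _ ≤ _ := by
        rw [hS]
        refine (card_union_le _ _).trans ?_
        rw [card_map, card_map, card_univ, card_range, add_comm]

/-- **Fan-ins of the unfolding**: `≤ #gates + #slots + 1`, above leaves of `≤ 1` slot. [folklore] -/
theorem swBnd_swUnfold {gs : List (Gate (⊤ : SimpleGraph (Fin n)).edgeSet)} (hwf : WF gs) :
    ∀ (ℓ : ℕ) (pol : Bool) (w : (⊤ : SimpleGraph (Fin n)).edgeSet ⊕ ℕ),
      swBnd (gs.length + Fintype.card (⊤ : SimpleGraph (Fin n)).edgeSet + 1) 1 ℓ (swUnfold gs ℓ pol w) := by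
  intro ℓ
  induction ℓ with
  | zero =>
    intro pol w
    cases w with
    | inl e => rw [swUnfold_zero_inl, swBnd_zero]; simp [swForm.leaf, swForm.sets]
    | inr m => rw [swUnfold_zero_inr, swBnd_zero]; simp [swForm.leaf, swForm.sets]
  | succ ℓ ih =>
    intro pol w
    cases w with
    | inl e =>
      rw [swUnfold_succ_inl, swBnd_succ]
      refine ⟨by simp [swForm.kids], fun g hg => ?_⟩
      simp only [swForm.kids, List.mem_singleton] at hg
      subst hg; exact ih _ _
    | inr m =>
      rw [swUnfold_succ_inr]
      by_cases hm : m < gs.length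
      · rw [dif_pos hm]
        by_cases hmatch : (gs[m]).fn = (if pol then GateFn.or (gs[m]).arity else GateFn.and (gs[m]).arity)
        · rw [if_pos hmatch, swBnd_succ]
          refine ⟨?_, fun g hg => ?_⟩
          · rw [swForm.kids, List.length_map]
            exact (length_dedup_args_le hwf hm).trans (Nat.le_succ _)
          · simp only [swForm.kids, List.mem_map] at hg
            obtain ⟨w', -, rfl⟩ := hg
            exact ih _ _
        · rw [if_neg hmatch, swBnd_succ]
          refine ⟨by simp [swForm.kids], fun g hg => ?_⟩
          simp only [swForm.kids, List.mem_singleton] at hg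
          subst hg; exact ih _ _
      · rw [dif_neg hm, swBnd_succ]
        exact ⟨by simp [swForm.kids], fun g hg => by simp [swForm.kids] at hg⟩

/-! ### `MonotoneBlind` for monotone AC⁰ circuits -/

/-- **The unfolding of a polynomial-size constant-depth monotone circuit**, eventually in `n`: the level-`(2d+1)`
unfolding of the output wire computes the circuit and has fan-ins `≤ n^{c+3}` above single slots. [folklore] -/
theorem eventually_swUnfold_circuit (c d : ℕ) (C : (n : ℕ) → Circuit ((⊤ : SimpleGraph (Fin n)).edgeSet))
    (hC : ∀ᶠ n : ℕ in atTop, (C n).IsOver monotoneACBasis ∧ (C n).size ≤ n ^ c ∧ (C n).acDepth ≤ d) :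
    ∀ᶠ n : ℕ in atTop,
      (∀ x : EdgeVec n, (swEval (2 * d + 1) false (swUnfold (C n).gates (2 * d + 1) false (C n).output) x ↔
        (C n).eval x = true)) ∧
      swBnd (n ^ (c + 3)) 1 (2 * d + 1) (swUnfold (C n).gates (2 * d + 1) false (C n).output) := by
  filter_upwards [hC, eventually_ge_atTop 3] with n hCn hn3
  refine ⟨fun x => ?_, ?_⟩
  · rw [circuit_eval_eq_wireFn]
    refine swEval_swUnfold (wf_gates (C n)) hCn.1 x (2 * d + 1) false (C n).output (C n).wf_output ?_
    rw [← circuit_acDepth_eq_wireHt]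
    have := hCn.2.2
    omega
  · refine swBnd_mono ?_ _ _ (swBnd_swUnfold (wf_gates (C n)) (2 * d + 1) false (C n).output)
    have hsize : (C n).gates.length ≤ n ^ c := hCn.2.1
    have hE := MonotoneBlind.VertexCover.card_edgeSet_top_le_sq n
    have h1 : n ^ c ≤ n ^ (c + 2) := Nat.pow_le_pow_right (by omega) (by omega)
    have h2 : n ^ 2 ≤ n ^ (c + 2) := Nat.pow_le_pow_right (by omega) (by omega)
    have h3 : 1 ≤ n ^ (c + 2) := Nat.one_le_pow _ _ (by omega)
    calc (C n).gates.length + Fintype.card (⊤ : SimpleGraph (Fin n)).edgeSet + 1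
        ≤ n ^ (c + 2) + n ^ (c + 2) + n ^ (c + 2) := Nat.add_le_add (Nat.add_le_add (hsize.trans h1) (hE.trans h2)) h3
      _ = 3 * n ^ (c + 2) := by ring
      _ ≤ n * n ^ (c + 2) := Nat.mul_le_mul_right _ hn3
      _ = n ^ (c + 3) := by ring

/-- **Weak blindness of polynomial-size monotone AC⁰ circuits (no quietness assumed).** For `0 < δ < 1/2`, `c d` and
circuits over `monotoneACBasis` with `size ≤ n^c`, `acDepth ≤ d` (eventually): eventually
`Pr_{G(n,1/2,⌈n^{1/2-δ}⌉)}[C n = 1] ≤ Pr_{G(n,1/2)}[C n = 1] + (2d+1)/n`. [folklore] -/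
theorem karlinRubin_AC0_planted_le_null_add {δ : ℝ} (hδ : 0 < δ) (hδ' : δ < 1 / 2) (c d : ℕ)
    (C : (n : ℕ) → Circuit ((⊤ : SimpleGraph (Fin n)).edgeSet))
    (hC : ∀ᶠ n : ℕ in atTop, (C n).IsOver monotoneACBasis ∧ (C n).size ≤ n ^ c ∧ (C n).acDepth ≤ d) :
    ∀ᶠ n : ℕ in atTop, (plantedCliqueDist n ⌈(n : ℝ) ^ (1 / 2 - δ)⌉₊).toOuterMeasure {x | (C n).eval x = true} ≤
      (erdosRenyiHalf n).toOuterMeasure {x | (C n).eval x = true} + ((2 * d + 1 : ℕ) : ℝ≥0∞) * ((n : ℝ≥0∞))⁻¹ := by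
  have hspec := eventually_swUnfold_circuit c d C hC
  have h := karlinRubin_constDepth_planted_le_null_add hδ hδ' (c + 3) (2 * d)
    (fun n => swUnfold (C n).gates (2 * d + 1) false (C n).output) (hspec.mono fun n hn => hn.2)
  filter_upwards [h, hspec] with n hn hspecn
  have h1 : {x : EdgeVec n | (C n).eval x = true} =
      {x | swEval (2 * d + 1) false (swUnfold (C n).gates (2 * d + 1) false (C n).output) x} := by
    ext x; exact (hspecn.1 x).symm
  rw [h1]
  exact hn

/-- **`MonotoneBlind` restricted to monotone AC⁰** (the crux's statement with `acDepth ≤ d` added and the basis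
enlarged to unbounded fan-in monotone gates): for `0 < δ < 1/2` and all `c d`, no sequence of circuits over
`monotoneACBasis` with `size ≤ n^c` and `acDepth ≤ d` (eventually) has
`Pr_{G(n,1/2)}[C n = 1] + Pr_{G(n,1/2,⌈n^{1/2-δ}⌉)}[C n = 0] → 0`. [folklore] -/
theorem karlinRubin_monotoneBlind_AC0 {δ : ℝ} (hδ : 0 < δ) (hδ' : δ < 1 / 2) (c d : ℕ) :
    ¬ ∃ C : (n : ℕ) → Circuit ((⊤ : SimpleGraph (Fin n)).edgeSet),
      (∀ᶠ n : ℕ in atTop, (C n).IsOver monotoneACBasis ∧ (C n).size ≤ n ^ c ∧ (C n).acDepth ≤ d) ∧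
      Tendsto (fun n : ℕ =>
        (erdosRenyiHalf n).toOuterMeasure {x | (C n).eval x = true} +
          (plantedCliqueDist n ⌈(n : ℝ) ^ (1 / 2 - δ)⌉₊).toOuterMeasure {x | (C n).eval x = false})
        atTop (𝓝 0) := by
  rintro ⟨C, hC, hT⟩
  have hspec := eventually_swUnfold_circuit c d C hC
  refine karlinRubin_monotoneBlind_constDepth' hδ hδ' (c + 3) (2 * d) false
    (fun n => swUnfold (C n).gates (2 * d + 1) false (C n).output) (hspec.mono fun n hn => hn.2) (hT.congr' ?_)
  filter_upwards [hspec] with n hn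
  have h1 : {x : EdgeVec n | (C n).eval x = true} =
      {x | swEval (2 * d + 1) false (swUnfold (C n).gates (2 * d + 1) false (C n).output) x} := by
    ext x; exact (hn.1 x).symm
  have h2 : {x : EdgeVec n | (C n).eval x = false} =
      {x | ¬ swEval (2 * d + 1) false (swUnfold (C n).gates (2 * d + 1) false (C n).output) x} := by
    ext x
    simp only [Set.mem_setOf_eq, hn.1 x, Bool.not_eq_true]
  rw [h1, h2]

/-- Registered stub `stub_monotoneBlindAC0` (side result of stmt-PneNP-18027, seat 0): the crux `MonotoneBlind` for
monotone AC⁰ circuits of every constant `acDepth`. [folklore] -/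
theorem stub_monotoneBlindAC0 : ∀ δ : ℝ, 0 < δ → δ < 1 / 2 → ∀ c d : ℕ, ¬ ∃ C : (n : ℕ) → Circuit ((⊤ : SimpleGraph (Fin n)).edgeSet), (∀ᶠ n : ℕ in Filter.atTop, (C n).IsOver Literature.Computability.Complexity.monotoneACBasis ∧ (C n).size ≤ n ^ c ∧ (C n).acDepth ≤ d) ∧ Filter.Tendsto (fun n : ℕ => (erdosRenyiHalf n).toOuterMeasure {x | (C n).eval x = true} + (plantedCliqueDist n ⌈(n : ℝ) ^ (1 / 2 - δ)⌉₊).toOuterMeasure {x | (C n).eval x = false}) Filter.atTop (nhds 0) :=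
  fun _ hδ hδ' c d => karlinRubin_monotoneBlind_AC0 hδ hδ' c d

end Summit.PneNP.PneNP.Theorems
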